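import Mathlib
import HarnessLib

/-!
# The rate in the Nyman–Beurling–Báez-Duarte criterion under the Riemann hypothesis (Balazard–de Roton 2010)

Topic `NumberTheory/LFunctions`, next to `NymanBeurling.lean` (Báez-Duarte's criterion
`Literature.NumberTheory.LFunctions.baezDuarte_iff`, the named facts `baezDuarte_onlyIf`,
`baezDuarte_moebiusSum_approx`, `baezDuarte_zetaRatio_bound`) and `BettinConreyFarmer2013.lean`
(`bcfDistSq`, the PROVED `BettinConreyFarmer2013_thm1_holds`: under RH AND condition (2),
`d_N² ≤ bcfDistSq N ~ (2+γ−log 4π)/log N`). Requested by route `RiemannHypothesis/NymanBeurling`,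
crux `NbRateOfRH` (stmt-RiemannHypothesis-1916: "under RH alone, `d_N² ≪ 1/log N`" — OPEN; the
named fact below is the best rate known in print under RH alone, the item being STRONGER).

## Source, verbatim

M. Balazard, A. de Roton, *Sur un critère de Báez-Duarte pour l'hypothèse de Riemann*, Int. J.
Number Theory 6 (2010) 883–903, doi:10.1142/s1793042110003307 = arXiv:0812.1689 (read: pp. 1–3 of
the arXiv version, `paper:arxiv-0812.1689`). With `H = L²(0, ∞; t⁻² dt)`, `χ` the indicator of
`[1, ∞[`, `e_α(t) = {t/α}` and `d_N = dist_H(χ, Vect(e_1, …, e_N))` (p. 2):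

> **Théorème 1.** L'hypothèse de Riemann entraîne que
> `d_N² ≪_δ (log log N)^{5/2+δ} (log N)^{-1/2}   (N ≥ 3)`, pour tout `δ > 0`.

(Abstract: "A theorem of Báez-Duarte states that the Riemann hypothesis (RH) holds if and only if
`d_N → 0` when `N → ∞`. Assuming RH, we prove the estimate
`d_N² ≤ (log log N)^{5/2+o(1)} (log N)^{-1/2}`." Context printed there: Burnol's lower bound
`d_N² ≥ (C+o(1))/log N`, `C = Σ_ρ m(ρ)²/|ρ|²`, and the BDBLS conjecture `d_N² ~ (2+γ−log 4π)/log N`.)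

## Design

* Under the change of variable `t = 1/x` (`dt/t² = dx`) the space `H` with `χ_{[1,∞[}`, `{t/n}`
  becomes `L²((0,∞), dx)` with `𝟙_{(0,1]}(x)` and `{1/(n x)}` — exactly the form of Báez-Duarte's
  criterion already in the tree (`baezDuarte_onlyIf`); we state the fact in that form, with the
  same coefficient convention `c : Fin N → ℝ`, `n = k + 1` (real coefficients suffice: all
  functions are real and the orthogonal projection of a real function on the span of real
  functions is real).
* `d_N² ≤ B` for the infimum is vendored as "there is a coefficient vector `c` whose squared
  `L²`-distance is `≤ C·(log log N)^{5/2+δ}(log N)^{-1/2}`" with an existential constant `C`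
  (depending on `δ` only) — implied by the printed `≪_δ` (replace the implied constant by twice
  it to pass from the infimum to an attained vector); the squared distance is written as a lower
  Lebesgue integral of `ENNReal.ofReal (·)²`, so no integrability side condition or junk value
  enters (the integrand is a bounded function minus an `O(1/x)` tail, always square integrable).
* `RiemannHypothesis` is Mathlib's.

## References

* [BalazardDeRoton2010] M. Balazard, A. de Roton, Sur un critère de Báez-Duarte pour l'hypothèse de
  Riemann, Int. J. Number Theory 6 (2010) 883–903, Théorème 1 (arXiv:0812.1689, p. 2).
* [BaezDuarte2003] L. Báez-Duarte, A strengthening of the Nyman–Beurling criterion for the Riemann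
  hypothesis, Rend. Lincei 14 (2003) 5–11 (the criterion; tree `NymanBeurling.lean`).
* [BettinConreyFarmer2013] S. Bettin, J. B. Conrey, D. W. Farmer, An optimal choice of Dirichlet
  polynomials for the Nyman–Beurling criterion, Proc. Steklov Inst. 280 (2013), Thm. 1 (tree,
  proved).
-/

noncomputable section

namespace Literature.NumberTheory.LFunctions

open MeasureTheory Set

/-- The squared `L²((0,∞))`-distance from `𝟙_{(0,1]}` to the combination
`x ↦ Σ_{k<N} c_k {1/((k+1)x)}` of the first `N` Beurling–Báez-Duarte functions (Báez-Duarte's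
form of Balazard–de Roton's `‖χ − Σ c_n e_n‖²_H`, `H = L²(0,∞; t⁻²dt)`, `e_n(t) = {t/n}`, after
`t = 1/x`), as a lower Lebesgue integral. [cite: BalazardDeRoton2010, §1 (definition of d_N)] -/
def baezDuarteDistSqOf (N : ℕ) (c : Fin N → ℝ) : ENNReal :=
  ∫⁻ x in Ioi (0 : ℝ), ENNReal.ofReal
    (((Ioc (0 : ℝ) 1).indicator 1 x -
        ∑ k : Fin N, c k * Int.fract (1 / (((k : ℕ) + 1 : ℝ) * x))) ^ 2)

/-- Unfolding of `baezDuarteDistSqOf`. [cite: BalazardDeRoton2010, §1 (definition of d_N)] -/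
theorem baezDuarteDistSqOf_eq (N : ℕ) (c : Fin N → ℝ) :
    baezDuarteDistSqOf N c = ∫⁻ x in Ioi (0 : ℝ), ENNReal.ofReal
      (((Ioc (0 : ℝ) 1).indicator 1 x -
          ∑ k : Fin N, c k * Int.fract (1 / (((k : ℕ) + 1 : ℝ) * x))) ^ 2) :=
  rfl

/-- **Balazard–de Roton 2010, Théorème 1** (the best known rate in the Nyman–Beurling–Báez-Duarte
criterion under RH alone): "L'hypothèse de Riemann entraîne que
`d_N² ≪_δ (log log N)^{5/2+δ}(log N)^{-1/2}` (`N ≥ 3`), pour tout `δ > 0`", where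
`d_N = dist_{L²(0,∞;t⁻²dt)}(χ_{[1,∞[}, Vect({t/1}, …, {t/N}))`; stated in Báez-Duarte's
`x = 1/t` form with an attained coefficient vector: under `RiemannHypothesis`, for every `δ > 0`
there is `C` such that for every `N ≥ 3` some real combination of `{1/(n x)}`, `n ≤ N`, is within
squared `L²((0,∞))`-distance `C (log log N)^{5/2+δ} (log N)^{-1/2}` of `𝟙_{(0,1]}`. (Compare:
Burnol's unconditional-order lower bound `d_N² ≥ (C'+o(1))/log N`, and the open question whether
`d_N² ≪ 1/log N` under RH alone — route item `NbRateOfRH`, which is stronger than this fact; under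
RH + BCF's condition (2) the tree proves `bcfDistSq N ~ (2+γ−log 4π)/log N`,
`BettinConreyFarmer2013_thm1_holds`.) Users take `(h : BalazardDeRoton2010_thm1)`.
[cite: BalazardDeRoton2010, Théorème 1] -/
def BalazardDeRoton2010_thm1 : Prop :=
  RiemannHypothesis → ∀ δ : ℝ, 0 < δ → ∃ C : ℝ, ∀ N : ℕ, 3 ≤ N → ∃ c : Fin N → ℝ,
    baezDuarteDistSqOf N c ≤
      ENNReal.ofReal (C * Real.log (Real.log (N : ℝ)) ^ (5 / 2 + δ) * Real.log (N : ℝ) ^ (-(1 / 2 : ℝ)))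

end Literature.NumberTheory.LFunctions

end
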